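import Summits.BirchSwinnertonDyer.Rank1Residual.GaloisImage.MordellWeilIndexCertificates
import HarnessLib

/-!
# Kernel certificate `27 ≤ [E′(ℚ) : 3E′(ℚ)]` from three points (team n1011, row T-DIV3L, FILE D11)

HONEST FRAMING (cell `b2b-bsdres`, run/shared/lean/b2b/bsd-rank1-residual/, verbatim in every
file): the goal of the cell is to DELETE the COMBINATION-SHAPED residual classes of the
Birch–Swinnerton-Dyer formula for ALL analytic-rank `≤ 1` elliptic curves over `ℚ` — "full BSD
formula for every rank `≤ 1` curve in class `C`" assembled STRICTLY from published theorems — so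
that the rank-`≤ 1` remainder becomes exactly the CONSTRUCTION-SHAPED classes, which are TYPED
(missing-input `Prop`s), NOT attempted. This is not "finishing BSD". Team n1011 (N10/N11): research
route; this file is a TOOL (pure group theory + kernel certificates); nothing is booked by it; no
mark / label moved; X4 stays CONSTRUCTION-SHAPED. THEOREMS only; no definition, no named fact, no
`sorry`.

## What

FILE D7 (`MordellWeilIndexCertificates`) certifies `9 ≤ [E′(ℚ):3E′(ℚ)]` from two points and four
non-divisibility certificates — the count road's input for a rank-`2` partner. r1's visibility tables
also carry 305 rank-`3` partners (27 'PASS-rank3' rows need the rank-3 inequality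
`#tors · ∏ t_v · 3 < 27 ≤ [E′(ℚ):3E′(ℚ)]` with ONE paid place). This file is the three-point twin:
with `H ⊇ 3G`, the map `(ℤ/3)³ → G/H`, `(a,b,c) ↦ aP₁ + bP₂ + cP₃`, is injective iff the 13 classes
`P₁, P₂, P₃, P₁ ± P₂, P₁ ± P₃, P₂ ± P₃, P₁ ± P₂ ± P₃` (up to sign) avoid `H`; each is ONE
`threeNonDivCheckAt` certificate (FILE D3) on a point computed by chord certificates (FILE D7).

* §1 `combo₃_not_mem_of_lt_three`, `eq_zero_of_combo₃_mem`, `twentyseven_le_index_of_not_mem`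
  (pure group theory, 27 residues).
* §2 END `twentyseven_le_index_range_zsmul_three_of_checks` (for any `DecidableEq ℚ` instance `d`,
  as D7's `_inst`): `W′ = ⟨a₁,…,a₆⟩` elliptic, three affine points, the ten compound points by
  chord identities, thirteen certificates ⟹ `27 ≤ (zsmulAddGroupHom 3).range.index`.

References: [SilvermanAEC2009] VIII.1 (weak Mordell–Weil: the index is finite), III.2.3 (group
law); certificates: this row's FILE D3.
-/

set_option autoImplicit false

open scoped Classical
open WeierstrassCurve

namespace Summit.BirchSwinnertonDyer.Rank1Residual.GaloisImage.DivisionDecider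

/-! ### §1 Pure group theory: `(ℤ/3)³ ↪ G/H` from thirteen residues -/

section Index

variable {G : Type*} [AddCommGroup G] (H : AddSubgroup G)

/-- If `H ⊇ 3G` and the thirteen classes `P₁, P₂, P₃, P₁ ± P₂, P₁ ± P₃, P₂ ± P₃, P₁ ± P₂ ± P₃` avoid
`H`, then so does every `r P₁ + s P₂ + t P₃` with `r, s, t ∈ {0,1,2}` not all zero (the 26 non-zero
residues, paired by negation). [folklore] -/
theorem combo₃_not_mem_of_lt_three (hH : ∀ g : G, (3 : ℤ) • g ∈ H) (P₁ P₂ P₃ : G)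
    (hpoo : P₁ ∉ H)
    (hopo : P₂ ∉ H)
    (hoop : P₃ ∉ H)
    (hppo : P₁ + P₂ ∉ H)
    (hpmo : P₁ - P₂ ∉ H)
    (hpop : P₁ + P₃ ∉ H)
    (hpom : P₁ - P₃ ∉ H)
    (hopp : P₂ + P₃ ∉ H)
    (hopm : P₂ - P₃ ∉ H)
    (hppp : P₁ + P₂ + P₃ ∉ H)
    (hppm : P₁ + P₂ - P₃ ∉ H)
    (hpmp : P₁ - P₂ + P₃ ∉ H)
    (hpmm : P₁ - P₂ - P₃ ∉ H)
    (r s t : ℤ) (hr : 0 ≤ r) (hr' : r < 3) (hs : 0 ≤ s) (hs' : s < 3) (ht : 0 ≤ t) (ht' : t < 3)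
    (hrst : ¬ (r = 0 ∧ s = 0 ∧ t = 0)) :
    r • P₁ + s • P₂ + t • P₃ ∉ H := by
  intro hmem
  interval_cases r <;> interval_cases s <;> interval_cases t
  · exact hrst ⟨rfl, rfl, rfl⟩
  · -- (0,0,1) ↦ P₃
    refine hoop ?_
    have e : P₃ = (1 : ℤ) • ((0 : ℤ) • P₁ + (0 : ℤ) • P₂ + (1 : ℤ) • P₃) -
        (3 : ℤ) • ((0 : ℤ) • P₁ + (0 : ℤ) • P₂ + (0 : ℤ) • P₃) := by module
    rw [e]; exact H.sub_mem (H.zsmul_mem hmem _) (hH _)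
  · -- (0,0,2) ↦ P₃
    refine hoop ?_
    have e : P₃ = (-1 : ℤ) • ((0 : ℤ) • P₁ + (0 : ℤ) • P₂ + (2 : ℤ) • P₃) -
        (3 : ℤ) • ((0 : ℤ) • P₁ + (0 : ℤ) • P₂ + (-1 : ℤ) • P₃) := by module
    rw [e]; exact H.sub_mem (H.zsmul_mem hmem _) (hH _)
  · -- (0,1,0) ↦ P₂
    refine hopo ?_
    have e : P₂ = (1 : ℤ) • ((0 : ℤ) • P₁ + (1 : ℤ) • P₂ + (0 : ℤ) • P₃) -
        (3 : ℤ) • ((0 : ℤ) • P₁ + (0 : ℤ) • P₂ + (0 : ℤ) • P₃) := by module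
    rw [e]; exact H.sub_mem (H.zsmul_mem hmem _) (hH _)
  · -- (0,1,1) ↦ P₂ + P₃
    refine hopp ?_
    have e : P₂ + P₃ = (1 : ℤ) • ((0 : ℤ) • P₁ + (1 : ℤ) • P₂ + (1 : ℤ) • P₃) -
        (3 : ℤ) • ((0 : ℤ) • P₁ + (0 : ℤ) • P₂ + (0 : ℤ) • P₃) := by module
    rw [e]; exact H.sub_mem (H.zsmul_mem hmem _) (hH _)
  · -- (0,1,2) ↦ P₂ - P₃
    refine hopm ?_
    have e : P₂ - P₃ = (1 : ℤ) • ((0 : ℤ) • P₁ + (1 : ℤ) • P₂ + (2 : ℤ) • P₃) -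
        (3 : ℤ) • ((0 : ℤ) • P₁ + (0 : ℤ) • P₂ + (1 : ℤ) • P₃) := by module
    rw [e]; exact H.sub_mem (H.zsmul_mem hmem _) (hH _)
  · -- (0,2,0) ↦ P₂
    refine hopo ?_
    have e : P₂ = (-1 : ℤ) • ((0 : ℤ) • P₁ + (2 : ℤ) • P₂ + (0 : ℤ) • P₃) -
        (3 : ℤ) • ((0 : ℤ) • P₁ + (-1 : ℤ) • P₂ + (0 : ℤ) • P₃) := by module
    rw [e]; exact H.sub_mem (H.zsmul_mem hmem _) (hH _)
  · -- (0,2,1) ↦ P₂ - P₃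
    refine hopm ?_
    have e : P₂ - P₃ = (-1 : ℤ) • ((0 : ℤ) • P₁ + (2 : ℤ) • P₂ + (1 : ℤ) • P₃) -
        (3 : ℤ) • ((0 : ℤ) • P₁ + (-1 : ℤ) • P₂ + (0 : ℤ) • P₃) := by module
    rw [e]; exact H.sub_mem (H.zsmul_mem hmem _) (hH _)
  · -- (0,2,2) ↦ P₂ + P₃
    refine hopp ?_
    have e : P₂ + P₃ = (-1 : ℤ) • ((0 : ℤ) • P₁ + (2 : ℤ) • P₂ + (2 : ℤ) • P₃) -
        (3 : ℤ) • ((0 : ℤ) • P₁ + (-1 : ℤ) • P₂ + (-1 : ℤ) • P₃) := by module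
    rw [e]; exact H.sub_mem (H.zsmul_mem hmem _) (hH _)
  · -- (1,0,0) ↦ P₁
    refine hpoo ?_
    have e : P₁ = (1 : ℤ) • ((1 : ℤ) • P₁ + (0 : ℤ) • P₂ + (0 : ℤ) • P₃) -
        (3 : ℤ) • ((0 : ℤ) • P₁ + (0 : ℤ) • P₂ + (0 : ℤ) • P₃) := by module
    rw [e]; exact H.sub_mem (H.zsmul_mem hmem _) (hH _)
  · -- (1,0,1) ↦ P₁ + P₃
    refine hpop ?_
    have e : P₁ + P₃ = (1 : ℤ) • ((1 : ℤ) • P₁ + (0 : ℤ) • P₂ + (1 : ℤ) • P₃) -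
        (3 : ℤ) • ((0 : ℤ) • P₁ + (0 : ℤ) • P₂ + (0 : ℤ) • P₃) := by module
    rw [e]; exact H.sub_mem (H.zsmul_mem hmem _) (hH _)
  · -- (1,0,2) ↦ P₁ - P₃
    refine hpom ?_
    have e : P₁ - P₃ = (1 : ℤ) • ((1 : ℤ) • P₁ + (0 : ℤ) • P₂ + (2 : ℤ) • P₃) -
        (3 : ℤ) • ((0 : ℤ) • P₁ + (0 : ℤ) • P₂ + (1 : ℤ) • P₃) := by module
    rw [e]; exact H.sub_mem (H.zsmul_mem hmem _) (hH _)
  · -- (1,1,0) ↦ P₁ + P₂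
    refine hppo ?_
    have e : P₁ + P₂ = (1 : ℤ) • ((1 : ℤ) • P₁ + (1 : ℤ) • P₂ + (0 : ℤ) • P₃) -
        (3 : ℤ) • ((0 : ℤ) • P₁ + (0 : ℤ) • P₂ + (0 : ℤ) • P₃) := by module
    rw [e]; exact H.sub_mem (H.zsmul_mem hmem _) (hH _)
  · -- (1,1,1) ↦ P₁ + P₂ + P₃
    refine hppp ?_
    have e : P₁ + P₂ + P₃ = (1 : ℤ) • ((1 : ℤ) • P₁ + (1 : ℤ) • P₂ + (1 : ℤ) • P₃) -
        (3 : ℤ) • ((0 : ℤ) • P₁ + (0 : ℤ) • P₂ + (0 : ℤ) • P₃) := by module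
    rw [e]; exact H.sub_mem (H.zsmul_mem hmem _) (hH _)
  · -- (1,1,2) ↦ P₁ + P₂ - P₃
    refine hppm ?_
    have e : P₁ + P₂ - P₃ = (1 : ℤ) • ((1 : ℤ) • P₁ + (1 : ℤ) • P₂ + (2 : ℤ) • P₃) -
        (3 : ℤ) • ((0 : ℤ) • P₁ + (0 : ℤ) • P₂ + (1 : ℤ) • P₃) := by module
    rw [e]; exact H.sub_mem (H.zsmul_mem hmem _) (hH _)
  · -- (1,2,0) ↦ P₁ - P₂
    refine hpmo ?_
    have e : P₁ - P₂ = (1 : ℤ) • ((1 : ℤ) • P₁ + (2 : ℤ) • P₂ + (0 : ℤ) • P₃) -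
        (3 : ℤ) • ((0 : ℤ) • P₁ + (1 : ℤ) • P₂ + (0 : ℤ) • P₃) := by module
    rw [e]; exact H.sub_mem (H.zsmul_mem hmem _) (hH _)
  · -- (1,2,1) ↦ P₁ - P₂ + P₃
    refine hpmp ?_
    have e : P₁ - P₂ + P₃ = (1 : ℤ) • ((1 : ℤ) • P₁ + (2 : ℤ) • P₂ + (1 : ℤ) • P₃) -
        (3 : ℤ) • ((0 : ℤ) • P₁ + (1 : ℤ) • P₂ + (0 : ℤ) • P₃) := by module
    rw [e]; exact H.sub_mem (H.zsmul_mem hmem _) (hH _)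
  · -- (1,2,2) ↦ P₁ - P₂ - P₃
    refine hpmm ?_
    have e : P₁ - P₂ - P₃ = (1 : ℤ) • ((1 : ℤ) • P₁ + (2 : ℤ) • P₂ + (2 : ℤ) • P₃) -
        (3 : ℤ) • ((0 : ℤ) • P₁ + (1 : ℤ) • P₂ + (1 : ℤ) • P₃) := by module
    rw [e]; exact H.sub_mem (H.zsmul_mem hmem _) (hH _)
  · -- (2,0,0) ↦ P₁
    refine hpoo ?_
    have e : P₁ = (-1 : ℤ) • ((2 : ℤ) • P₁ + (0 : ℤ) • P₂ + (0 : ℤ) • P₃) -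
        (3 : ℤ) • ((-1 : ℤ) • P₁ + (0 : ℤ) • P₂ + (0 : ℤ) • P₃) := by module
    rw [e]; exact H.sub_mem (H.zsmul_mem hmem _) (hH _)
  · -- (2,0,1) ↦ P₁ - P₃
    refine hpom ?_
    have e : P₁ - P₃ = (-1 : ℤ) • ((2 : ℤ) • P₁ + (0 : ℤ) • P₂ + (1 : ℤ) • P₃) -
        (3 : ℤ) • ((-1 : ℤ) • P₁ + (0 : ℤ) • P₂ + (0 : ℤ) • P₃) := by module
    rw [e]; exact H.sub_mem (H.zsmul_mem hmem _) (hH _)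
  · -- (2,0,2) ↦ P₁ + P₃
    refine hpop ?_
    have e : P₁ + P₃ = (-1 : ℤ) • ((2 : ℤ) • P₁ + (0 : ℤ) • P₂ + (2 : ℤ) • P₃) -
        (3 : ℤ) • ((-1 : ℤ) • P₁ + (0 : ℤ) • P₂ + (-1 : ℤ) • P₃) := by module
    rw [e]; exact H.sub_mem (H.zsmul_mem hmem _) (hH _)
  · -- (2,1,0) ↦ P₁ - P₂
    refine hpmo ?_
    have e : P₁ - P₂ = (-1 : ℤ) • ((2 : ℤ) • P₁ + (1 : ℤ) • P₂ + (0 : ℤ) • P₃) -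
        (3 : ℤ) • ((-1 : ℤ) • P₁ + (0 : ℤ) • P₂ + (0 : ℤ) • P₃) := by module
    rw [e]; exact H.sub_mem (H.zsmul_mem hmem _) (hH _)
  · -- (2,1,1) ↦ P₁ - P₂ - P₃
    refine hpmm ?_
    have e : P₁ - P₂ - P₃ = (-1 : ℤ) • ((2 : ℤ) • P₁ + (1 : ℤ) • P₂ + (1 : ℤ) • P₃) -
        (3 : ℤ) • ((-1 : ℤ) • P₁ + (0 : ℤ) • P₂ + (0 : ℤ) • P₃) := by module
    rw [e]; exact H.sub_mem (H.zsmul_mem hmem _) (hH _)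
  · -- (2,1,2) ↦ P₁ - P₂ + P₃
    refine hpmp ?_
    have e : P₁ - P₂ + P₃ = (-1 : ℤ) • ((2 : ℤ) • P₁ + (1 : ℤ) • P₂ + (2 : ℤ) • P₃) -
        (3 : ℤ) • ((-1 : ℤ) • P₁ + (0 : ℤ) • P₂ + (-1 : ℤ) • P₃) := by module
    rw [e]; exact H.sub_mem (H.zsmul_mem hmem _) (hH _)
  · -- (2,2,0) ↦ P₁ + P₂
    refine hppo ?_
    have e : P₁ + P₂ = (-1 : ℤ) • ((2 : ℤ) • P₁ + (2 : ℤ) • P₂ + (0 : ℤ) • P₃) -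
        (3 : ℤ) • ((-1 : ℤ) • P₁ + (-1 : ℤ) • P₂ + (0 : ℤ) • P₃) := by module
    rw [e]; exact H.sub_mem (H.zsmul_mem hmem _) (hH _)
  · -- (2,2,1) ↦ P₁ + P₂ - P₃
    refine hppm ?_
    have e : P₁ + P₂ - P₃ = (-1 : ℤ) • ((2 : ℤ) • P₁ + (2 : ℤ) • P₂ + (1 : ℤ) • P₃) -
        (3 : ℤ) • ((-1 : ℤ) • P₁ + (-1 : ℤ) • P₂ + (0 : ℤ) • P₃) := by module
    rw [e]; exact H.sub_mem (H.zsmul_mem hmem _) (hH _)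
  · -- (2,2,2) ↦ P₁ + P₂ + P₃
    refine hppp ?_
    have e : P₁ + P₂ + P₃ = (-1 : ℤ) • ((2 : ℤ) • P₁ + (2 : ℤ) • P₂ + (2 : ℤ) • P₃) -
        (3 : ℤ) • ((-1 : ℤ) • P₁ + (-1 : ℤ) • P₂ + (-1 : ℤ) • P₃) := by module
    rw [e]; exact H.sub_mem (H.zsmul_mem hmem _) (hH _)

/-- Small integer combinations: if `c P₁ + d P₂ + e P₃ ∈ H` with `|c|, |d|, |e| ≤ 2` then
`c = d = e = 0`. [folklore] -/
theorem eq_zero_of_combo₃_mem (hH : ∀ g : G, (3 : ℤ) • g ∈ H) (P₁ P₂ P₃ : G)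
    (hpoo : P₁ ∉ H)
    (hopo : P₂ ∉ H)
    (hoop : P₃ ∉ H)
    (hppo : P₁ + P₂ ∉ H)
    (hpmo : P₁ - P₂ ∉ H)
    (hpop : P₁ + P₃ ∉ H)
    (hpom : P₁ - P₃ ∉ H)
    (hopp : P₂ + P₃ ∉ H)
    (hopm : P₂ - P₃ ∉ H)
    (hppp : P₁ + P₂ + P₃ ∉ H)
    (hppm : P₁ + P₂ - P₃ ∉ H)
    (hpmp : P₁ - P₂ + P₃ ∉ H)
    (hpmm : P₁ - P₂ - P₃ ∉ H)
    (c d e : ℤ) (hc : -2 ≤ c) (hc' : c ≤ 2) (hd : -2 ≤ d) (hd' : d ≤ 2) (he : -2 ≤ e) (he' : e ≤ 2)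
    (hmem : c • P₁ + d • P₂ + e • P₃ ∈ H) : c = 0 ∧ d = 0 ∧ e = 0 := by
  set r := c % 3 with hr
  set s := d % 3 with hs
  set t := e % 3 with ht
  have hcr : r = c - 3 * (c / 3) := by omega
  have hds : s = d - 3 * (d / 3) := by omega
  have het : t = e - 3 * (e / 3) := by omega
  have hmem' : r • P₁ + s • P₂ + t • P₃ ∈ H := by
    have e' : r • P₁ + s • P₂ + t • P₃ =
        (c • P₁ + d • P₂ + e • P₃) - (3 : ℤ) • ((c / 3) • P₁ + (d / 3) • P₂ + (e / 3) • P₃) := by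
      rw [hcr, hds, het]
      module
    rw [e']
    exact H.sub_mem hmem (hH _)
  by_cases hrst : r = 0 ∧ s = 0 ∧ t = 0
  · obtain ⟨hr0, hs0, ht0⟩ := hrst
    omega
  · exact absurd hmem' (combo₃_not_mem_of_lt_three H hH P₁ P₂ P₃ hpoo hopo hoop hppo hpmo hpop hpom hopp hopm hppp hppm hpmp hpmm r s t
      (by omega) (by omega) (by omega) (by omega) (by omega) (by omega) hrst)

/-- **`27 ≤ [G : H]`** when `H ⊇ 3G` has non-zero index and the thirteen classes avoid `H`: the 27
classes `r P₁ + s P₂ + t P₃ + H`, `r, s, t ∈ {0,1,2}`, are pairwise distinct. [folklore] -/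
theorem twentyseven_le_index_of_not_mem (hH : ∀ g : G, (3 : ℤ) • g ∈ H) (P₁ P₂ P₃ : G)
    (hpoo : P₁ ∉ H)
    (hopo : P₂ ∉ H)
    (hoop : P₃ ∉ H)
    (hppo : P₁ + P₂ ∉ H)
    (hpmo : P₁ - P₂ ∉ H)
    (hpop : P₁ + P₃ ∉ H)
    (hpom : P₁ - P₃ ∉ H)
    (hopp : P₂ + P₃ ∉ H)
    (hopm : P₂ - P₃ ∉ H)
    (hppp : P₁ + P₂ + P₃ ∉ H)
    (hppm : P₁ + P₂ - P₃ ∉ H)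
    (hpmp : P₁ - P₂ + P₃ ∉ H)
    (hpmm : P₁ - P₂ - P₃ ∉ H)
    (hfin : H.index ≠ 0) : 27 ≤ H.index := by
  haveI : Fintype (G ⧸ H) := AddSubgroup.fintypeOfIndexNeZero hfin
  let g : Fin 3 × Fin 3 × Fin 3 → G ⧸ H := fun u =>
    QuotientAddGroup.mk (((u.1 : ℕ) : ℤ) • P₁ + ((u.2.1 : ℕ) : ℤ) • P₂ + ((u.2.2 : ℕ) : ℤ) • P₃)
  have hg : Function.Injective g := by
    rintro ⟨a, b, c⟩ ⟨a', b', c'⟩ huv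
    have hmem := (QuotientAddGroup.eq (s := H)).mp huv
    have e : -((((a : ℕ) : ℤ)) • P₁ + (((b : ℕ) : ℤ)) • P₂ + (((c : ℕ) : ℤ)) • P₃) +
        ((((a' : ℕ) : ℤ)) • P₁ + (((b' : ℕ) : ℤ)) • P₂ + (((c' : ℕ) : ℤ)) • P₃) =
        (((a' : ℕ) : ℤ) - ((a : ℕ) : ℤ)) • P₁ + (((b' : ℕ) : ℤ) - ((b : ℕ) : ℤ)) • P₂ +
          (((c' : ℕ) : ℤ) - ((c : ℕ) : ℤ)) • P₃ := by
      module
    rw [e] at hmem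
    have ha := a.2; have ha' := a'.2; have hb := b.2; have hb' := b'.2; have hc := c.2
    have hc' := c'.2
    obtain ⟨h1, h2, h3⟩ := eq_zero_of_combo₃_mem H hH P₁ P₂ P₃ hpoo hopo hoop hppo hpmo hpop hpom hopp hopm hppp hppm hpmp hpmm _ _ _
      (by omega) (by omega) (by omega) (by omega) (by omega) (by omega) hmem
    have haa : (a : ℕ) = a' := by omega
    have hbb : (b : ℕ) = b' := by omega
    have hcc : (c : ℕ) = c' := by omega
    exact Prod.ext (Fin.ext haa) (Prod.ext (Fin.ext hbb) (Fin.ext hcc))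
  have hcard := Fintype.card_le_of_injective g hg
  rw [Fintype.card_prod, Fintype.card_prod, Fintype.card_fin] at hcard
  rw [AddSubgroup.index, Nat.card_eq_fintype_card]
  exact hcard

end Index

/-! ### §2 The END for `E′ = ⟨a₁, …, a₆⟩ / ℚ` with three points -/

section Main

variable (a₁ a₂ a₃ a₄ a₆ : ℤ)

/-- **KERNEL CERTIFICATE `27 ≤ [E′(ℚ) : 3E′(ℚ)]`.** For the elliptic `W′ = ⟨a₁, …, a₆⟩ / ℚ`, three
affine points `Pᵢ = (xᵢ, yᵢ)`, the ten compound points `P₁ ± P₂ = (u₁,v₁), (u₂,v₂)`,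
`P₁ ± P₃ = (u₃,v₃), (u₄,v₄)`, `P₂ ± P₃ = (u₅,v₅), (u₆,v₆)`, `(P₁+P₂) ± P₃ = (u₇,v₇), (u₈,v₈)`,
`(P₁−P₂) ± P₃ = (u₉,v₉), (u₁₀,v₁₀)` given by CHORD IDENTITIES (decidable rational equalities, D7
`add_eq_some_of_coords` / `sub_eq_some_of_coords`), and thirteen NON-`3`-DIVISIBILITY certificates
(D3 `threeNonDivCheckAt … = true` at auxiliary primes `ℓ₁,…,ℓ₁₃`), the subgroup `3E′(ℚ)` has index
`≥ 27` — i.e. `rank E′(ℚ) + dim E′(ℚ)[3] ≥ 3` certified in the kernel (finiteness of the index from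
the tree's weak Mordell–Weil `pow_mordellWeilRank_le_index_range_zsmul`). Stated for ANY
`DecidableEq ℚ` instance `d` on the point group (pass `instDecidableEqRat`, or the classical one of the
tree's count theorems; the transport is `Subsingleton.elim`, as in D7's `_inst`).
[cite: SilvermanAEC2009, VIII.1 and III.2.3] -/
theorem twentyseven_le_index_range_zsmul_three_of_checks (W' : WeierstrassCurve ℚ) [W'.IsElliptic]
    (hW' : W' = ⟨a₁, a₂, a₃, a₄, a₆⟩)
    {x₁ y₁ x₂ y₂ x₃ y₃ u₁ v₁ u₂ v₂ u₃ v₃ u₄ v₄ u₅ v₅ u₆ v₆ u₇ v₇ u₈ v₈ u₉ v₉ u₁₀ v₁₀ : ℚ}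
    (h₁ : W'.toAffine.Nonsingular x₁ y₁) (h₂ : W'.toAffine.Nonsingular x₂ y₂)
    (h₃ : W'.toAffine.Nonsingular x₃ y₃)
    (n₁ : W'.toAffine.Nonsingular u₁ v₁)
    (n₂ : W'.toAffine.Nonsingular u₂ v₂)
    (n₃ : W'.toAffine.Nonsingular u₃ v₃)
    (n₄ : W'.toAffine.Nonsingular u₄ v₄)
    (n₅ : W'.toAffine.Nonsingular u₅ v₅)
    (n₆ : W'.toAffine.Nonsingular u₆ v₆)
    (n₇ : W'.toAffine.Nonsingular u₇ v₇)
    (n₈ : W'.toAffine.Nonsingular u₈ v₈)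
    (n₉ : W'.toAffine.Nonsingular u₉ v₉)
    (n₁₀ : W'.toAffine.Nonsingular u₁₀ v₁₀)
    (hx₁ : x₁ ≠ x₂) (hx₂ : x₁ ≠ x₃) (hx₃ : x₂ ≠ x₃) (hx₄ : u₁ ≠ x₃) (hx₅ : u₂ ≠ x₃)
    (hX₁ : W'.toAffine.addX x₁ x₂ ((y₁ - y₂) / (x₁ - x₂)) = u₁)
    (hY₁ : W'.toAffine.addY x₁ x₂ y₁ ((y₁ - y₂) / (x₁ - x₂)) = v₁)
    (hX₂ : W'.toAffine.addX x₁ x₂ ((y₁ - W'.toAffine.negY x₂ y₂) / (x₁ - x₂)) = u₂)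
    (hY₂ : W'.toAffine.addY x₁ x₂ y₁ ((y₁ - W'.toAffine.negY x₂ y₂) / (x₁ - x₂)) = v₂)
    (hX₃ : W'.toAffine.addX x₁ x₃ ((y₁ - y₃) / (x₁ - x₃)) = u₃)
    (hY₃ : W'.toAffine.addY x₁ x₃ y₁ ((y₁ - y₃) / (x₁ - x₃)) = v₃)
    (hX₄ : W'.toAffine.addX x₁ x₃ ((y₁ - W'.toAffine.negY x₃ y₃) / (x₁ - x₃)) = u₄)
    (hY₄ : W'.toAffine.addY x₁ x₃ y₁ ((y₁ - W'.toAffine.negY x₃ y₃) / (x₁ - x₃)) = v₄)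
    (hX₅ : W'.toAffine.addX x₂ x₃ ((y₂ - y₃) / (x₂ - x₃)) = u₅)
    (hY₅ : W'.toAffine.addY x₂ x₃ y₂ ((y₂ - y₃) / (x₂ - x₃)) = v₅)
    (hX₆ : W'.toAffine.addX x₂ x₃ ((y₂ - W'.toAffine.negY x₃ y₃) / (x₂ - x₃)) = u₆)
    (hY₆ : W'.toAffine.addY x₂ x₃ y₂ ((y₂ - W'.toAffine.negY x₃ y₃) / (x₂ - x₃)) = v₆)
    (hX₇ : W'.toAffine.addX u₁ x₃ ((v₁ - y₃) / (u₁ - x₃)) = u₇)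
    (hY₇ : W'.toAffine.addY u₁ x₃ v₁ ((v₁ - y₃) / (u₁ - x₃)) = v₇)
    (hX₈ : W'.toAffine.addX u₁ x₃ ((v₁ - W'.toAffine.negY x₃ y₃) / (u₁ - x₃)) = u₈)
    (hY₈ : W'.toAffine.addY u₁ x₃ v₁ ((v₁ - W'.toAffine.negY x₃ y₃) / (u₁ - x₃)) = v₈)
    (hX₉ : W'.toAffine.addX u₂ x₃ ((v₂ - y₃) / (u₂ - x₃)) = u₉)
    (hY₉ : W'.toAffine.addY u₂ x₃ v₂ ((v₂ - y₃) / (u₂ - x₃)) = v₉)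
    (hX₁₀ : W'.toAffine.addX u₂ x₃ ((v₂ - W'.toAffine.negY x₃ y₃) / (u₂ - x₃)) = u₁₀)
    (hY₁₀ : W'.toAffine.addY u₂ x₃ v₂ ((v₂ - W'.toAffine.negY x₃ y₃) / (u₂ - x₃)) = v₁₀)
    {ℓ₁ ℓ₂ ℓ₃ ℓ₄ ℓ₅ ℓ₆ ℓ₇ ℓ₈ ℓ₉ ℓ₁₀ ℓ₁₁ ℓ₁₂ ℓ₁₃ : ℕ} [hℓ₁ : Fact ℓ₁.Prime] [hℓ₂ : Fact ℓ₂.Prime] [hℓ₃ : Fact ℓ₃.Prime] [hℓ₄ : Fact ℓ₄.Prime] [hℓ₅ : Fact ℓ₅.Prime] [hℓ₆ : Fact ℓ₆.Prime] [hℓ₇ : Fact ℓ₇.Prime] [hℓ₈ : Fact ℓ₈.Prime] [hℓ₉ : Fact ℓ₉.Prime] [hℓ₁₀ : Fact ℓ₁₀.Prime] [hℓ₁₁ : Fact ℓ₁₁.Prime] [hℓ₁₂ : Fact ℓ₁₂.Prime] [hℓ₁₃ : Fact ℓ₁₃.Prime]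
    {k₁ k₂ k₃ k₄ k₅ k₆ k₇ k₈ k₉ k₁₀ k₁₁ k₁₂ k₁₃ : ℕ}
    (hc₁ : threeNonDivCheckAt ℓ₁ a₁ a₂ a₃ a₄ a₆ x₁.num x₁.den k₁ = true)
    (hc₂ : threeNonDivCheckAt ℓ₂ a₁ a₂ a₃ a₄ a₆ x₂.num x₂.den k₂ = true)
    (hc₃ : threeNonDivCheckAt ℓ₃ a₁ a₂ a₃ a₄ a₆ x₃.num x₃.den k₃ = true)
    (hc₄ : threeNonDivCheckAt ℓ₄ a₁ a₂ a₃ a₄ a₆ u₁.num u₁.den k₄ = true)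
    (hc₅ : threeNonDivCheckAt ℓ₅ a₁ a₂ a₃ a₄ a₆ u₂.num u₂.den k₅ = true)
    (hc₆ : threeNonDivCheckAt ℓ₆ a₁ a₂ a₃ a₄ a₆ u₃.num u₃.den k₆ = true)
    (hc₇ : threeNonDivCheckAt ℓ₇ a₁ a₂ a₃ a₄ a₆ u₄.num u₄.den k₇ = true)
    (hc₈ : threeNonDivCheckAt ℓ₈ a₁ a₂ a₃ a₄ a₆ u₅.num u₅.den k₈ = true)
    (hc₉ : threeNonDivCheckAt ℓ₉ a₁ a₂ a₃ a₄ a₆ u₆.num u₆.den k₉ = true)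
    (hc₁₀ : threeNonDivCheckAt ℓ₁₀ a₁ a₂ a₃ a₄ a₆ u₇.num u₇.den k₁₀ = true)
    (hc₁₁ : threeNonDivCheckAt ℓ₁₁ a₁ a₂ a₃ a₄ a₆ u₈.num u₈.den k₁₁ = true)
    (hc₁₂ : threeNonDivCheckAt ℓ₁₂ a₁ a₂ a₃ a₄ a₆ u₉.num u₉.den k₁₂ = true)
    (hc₁₃ : threeNonDivCheckAt ℓ₁₃ a₁ a₂ a₃ a₄ a₆ u₁₀.num u₁₀.den k₁₃ = true) (d : DecidableEq ℚ) :
    27 ≤ (letI : DecidableEq ℚ := d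
      (zsmulAddGroupHom ((3 : ℕ) : ℤ) : W'.toAffine.Point →+ W'.toAffine.Point).range.index) := by
  -- any `DecidableEq ℚ` instance on the point group (Mathlib's computable one here, the classical
  -- one in the tree's count theorems) gives the SAME subgroup: transport along `Subsingleton.elim`
  obtain rfl : d = instDecidableEqRat := Subsingleton.elim _ _
  set H := (zsmulAddGroupHom ((3 : ℕ) : ℤ) : W'.toAffine.Point →+ W'.toAffine.Point).range with hH
  have hmem : ∀ g : W'.toAffine.Point, (3 : ℤ) • g ∈ H := fun g => ⟨g, rfl⟩
  have hP₁ := not_mem_range_zsmul_three_of_check ℓ₁ a₁ a₂ a₃ a₄ a₆ W' hW' h₁ hc₁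
  have hP₂ := not_mem_range_zsmul_three_of_check ℓ₂ a₁ a₂ a₃ a₄ a₆ W' hW' h₂ hc₂
  have hP₃ := not_mem_range_zsmul_three_of_check ℓ₃ a₁ a₂ a₃ a₄ a₆ W' hW' h₃ hc₃
  have hP₄ := not_mem_range_zsmul_three_of_check ℓ₄ a₁ a₂ a₃ a₄ a₆ W' hW' n₁ hc₄
  have hP₅ := not_mem_range_zsmul_three_of_check ℓ₅ a₁ a₂ a₃ a₄ a₆ W' hW' n₂ hc₅
  have hP₆ := not_mem_range_zsmul_three_of_check ℓ₆ a₁ a₂ a₃ a₄ a₆ W' hW' n₃ hc₆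
  have hP₇ := not_mem_range_zsmul_three_of_check ℓ₇ a₁ a₂ a₃ a₄ a₆ W' hW' n₄ hc₇
  have hP₈ := not_mem_range_zsmul_three_of_check ℓ₈ a₁ a₂ a₃ a₄ a₆ W' hW' n₅ hc₈
  have hP₉ := not_mem_range_zsmul_three_of_check ℓ₉ a₁ a₂ a₃ a₄ a₆ W' hW' n₆ hc₉
  have hP₁₀ := not_mem_range_zsmul_three_of_check ℓ₁₀ a₁ a₂ a₃ a₄ a₆ W' hW' n₇ hc₁₀
  have hP₁₁ := not_mem_range_zsmul_three_of_check ℓ₁₁ a₁ a₂ a₃ a₄ a₆ W' hW' n₈ hc₁₁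
  have hP₁₂ := not_mem_range_zsmul_three_of_check ℓ₁₂ a₁ a₂ a₃ a₄ a₆ W' hW' n₉ hc₁₂
  have hP₁₃ := not_mem_range_zsmul_three_of_check ℓ₁₃ a₁ a₂ a₃ a₄ a₆ W' hW' n₁₀ hc₁₃
  rw [← sub_eq_some_of_coords W' n₂ h₃ n₁₀ hx₅ hX₁₀ hY₁₀] at hP₁₃
  rw [← add_eq_some_of_coords W' n₂ h₃ n₉ hx₅ hX₉ hY₉] at hP₁₂
  rw [← sub_eq_some_of_coords W' n₁ h₃ n₈ hx₄ hX₈ hY₈] at hP₁₁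
  rw [← add_eq_some_of_coords W' n₁ h₃ n₇ hx₄ hX₇ hY₇] at hP₁₀
  rw [← sub_eq_some_of_coords W' h₂ h₃ n₆ hx₃ hX₆ hY₆] at hP₉
  rw [← add_eq_some_of_coords W' h₂ h₃ n₅ hx₃ hX₅ hY₅] at hP₈
  rw [← sub_eq_some_of_coords W' h₁ h₃ n₄ hx₂ hX₄ hY₄] at hP₇
  rw [← add_eq_some_of_coords W' h₁ h₃ n₃ hx₂ hX₃ hY₃] at hP₆
  rw [← sub_eq_some_of_coords W' h₁ h₂ n₂ hx₁ hX₂ hY₂] at hP₅ hP₁₂ hP₁₃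
  rw [← add_eq_some_of_coords W' h₁ h₂ n₁ hx₁ hX₁ hY₁] at hP₄ hP₁₀ hP₁₁
  have hfin : H.index ≠ 0 := by
    have key : ∀ d : DecidableEq ℚ, 3 ^ W'.mordellWeilRank ≤
        (letI : DecidableEq ℚ := d
         (zsmulAddGroupHom ((3 : ℕ) : ℤ) : W'.toAffine.Point →+ W'.toAffine.Point).range.index) := by
      intro d
      obtain rfl : d = fun a b => Classical.propDecidable (a = b) := Subsingleton.elim _ _
      exact pow_mordellWeilRank_le_index_range_zsmul W' (n := 3) (by norm_num)
    have h3 : 3 ^ W'.mordellWeilRank ≤ H.index := key inferInstance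
    intro h0
    rw [h0] at h3
    exact absurd h3 (not_le.mpr (pow_pos (by norm_num) _))
  exact twentyseven_le_index_of_not_mem H hmem _ _ _ hP₁ hP₂ hP₃ hP₄ hP₅ hP₆ hP₇ hP₈ hP₉ hP₁₀ hP₁₁ hP₁₂ hP₁₃ hfin

end Main

end Summit.BirchSwinnertonDyer.Rank1Residual.GaloisImage.DivisionDecider
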